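import Mathlib
import Summits.NavierStokesRegularity.NavierStokesRegularity.Theorems.SubcriticalEnvelopeForwardSourceTailEnvelopeKPNormalForm
import HarnessLib

/-!
# The two STRUCTURAL INEQUALITIES of the pair slaving lemma, read off the normal form of a KP network
proper (helper file for crux stmt-NavierStokesRegularity-27057 `SubOnsagerCeiling.ForwardTailCeilingKP`,
`--supports … --as helper`; companion of `SubOnsagerCeilingKPPairSlaving`)

`kpProper_pairSlaving` (sibling file) bounds a forward source `X_{a,n}` of a KP network proper through
its Katz–Pavlović pair with its target `X_{e,n+1}` (weight `w = α a a e (0,0,1) > 0`,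
`λ = w(1+ε₀)^{5n/2}`), given the two structural inequalities
`hIn : quadTerm_a(n) ≤ I₀ − λ X_{a,n} X_{e,n+1}` and `hOut : quadTerm_e(n+1) ≥ λ X_{a,n}² − ρ₀ X_{e,n+1}`.
This file derives both from the normal form `kpProper_quadTerm` (p640757) for non-negative shell
vectors, in the sharp «drop only signed terms» form:

* `kpProper_quadTerm_source_le` — the source side: `quadTerm_a(n) ≤ IN_a(n) − λ X_{a,n} X_{e,n+1}` with
  `IN_a(n) = (1+ε₀)^{5(n-1)/2} Σ_{a'} w_{a'a} X_{a',n-1}² + (1+ε₀)^{5n/2} Q_a(X̂_{·,n})`, `X̂` = the shell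
  vector with the `a`-entry zeroed (every other feed drain `−w_{aj}X_aX_{j,n+1}` and every pump drain
  `−P_{a→j}X_aX_j` is `≤ 0` and dropped);
* `kpProper_quadTerm_target_ge` — the target side:
  `quadTerm_e(n+1) ≥ λ X_{a,n}² − X_{e,n+1}·(1+ε₀)^{5(n+1)/2}·(Σ_j w_{ej} X_{j,n+2} + Σ_j P_{e→j} X_{j,n+1})`
  (the other feeds into `e` and the in-shell form on the face `{X_e = 0}` are `≥ 0` by the orthant
  clause and dropped);
* the coefficient facts used: `kpProper_inShell_diag_zero` (`α e e e (0,0,0) = 0`),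
  `kpProper_inShell_back` (`α e j e 0 + α j e e 0 = −α e e j 0`: a pump's back-reaction),
  `kpProper_pump_nonneg` (`P_{e→j} = α e e j (0,0,0) ≥ 0`, `j ≠ e`), and the algebraic split
  `inShell_form_split` of a shell form into its face part, its `y_e`-linear part and its diagonal.

So, along a non-negative solution, `I₀` is any bound of `IN_a(n)` (quadratic in the amplitudes of the
feeders of `a`) and `ρ₀` any bound of the bracket (linear in the amplitudes of the partners of `e`):
the pair lemma turns envelopes of NEIGHBOURS into an envelope of the source, scale-covariantly.

HONEST FRAMING: algebra/inequalities about Tao-type MODEL lattice tables (rung TL-M2Break, route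
SubOnsagerCeiling); an ingredient of, not a proof of, the crux; nothing here bears on Navier–Stokes.
-/

noncomputable section

-- the sub-problem namespace `NavierStokesRegularity.NavierStokesRegularity` is the tree's layout (D-0017)
set_option linter.dupNamespace false

namespace Summit.NavierStokesRegularity.NavierStokesRegularity.Theorems

open Finset
open Literature.Analysis.FluidPDE.TaoCascade

variable {α : Fin 4 → Fin 4 → Fin 4 → ℤ × ℤ × ℤ → ℝ}

/-! ## §1 In-shell coefficient facts -/

/-- The shift `(0,0,0)` belongs to Tao's shift set. [cite: Tao2016AveragedNS, §4 after (4.1)] -/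
theorem kpProper_mem000 : ((0 : ℤ), (0 : ℤ), (0 : ℤ)) ∈ shiftSet :=
  (mem_shiftSet_iff _).2 (Or.inl rfl)

/-- **No cubic self-interaction in shell**: `α e e e (0,0,0) = 0` ((4.3) on the orbit of `(e,e,e)`).
[cite: Tao2016AveragedNS, §4 (4.3)] -/
theorem kpProper_inShell_diag_zero (hc : IsCancellingCoeff α) (e : Fin 4) : α e e e (0, 0, 0) = 0 := by
  have h := hc e e e 0 0 0 kpProper_mem000
  linarith

/-- **A pump's back-reaction** ((4.3) on the orbit of `(e,e,j)` in shell): the coefficient of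
`y_e y_j` in the equation of `e` is minus the pump weight `P_{e→j} = α e e j (0,0,0)` of `y_e² → y_j'`.
[cite: Tao2016AveragedNS, §4 (4.3)] -/
theorem kpProper_inShell_back (hc : IsCancellingCoeff α) (e j : Fin 4) :
    α e j e (0, 0, 0) + α j e e (0, 0, 0) = -α e e j (0, 0, 0) := by
  have h := hc e e j 0 0 0 kpProper_mem000
  linarith

/-- **Pump weights are non-negative** on an orthant table: `0 ≤ α e e j (0,0,0)` for `j ≠ e` (clause (3)
of `orthant_iff_coefficients` at the coordinate vector `e_e`, whose `j`-entry vanishes). [this file] -/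
theorem kpProper_pump_nonneg
    (hO : ∀ (Y : Fin 4 → ℤ → ℝ → ℝ) (τ : ℝ), (∀ (j : Fin 4) (k : ℤ), 1 ≤ k → 0 ≤ Y j k τ) →
      ∀ δ : ℝ, 0 < δ → ∀ (i : Fin 4) (n : ℤ), 1 ≤ n → Y i n τ = 0 → 0 ≤ quadTerm δ α Y i n τ)
    {e j : Fin 4} (hje : j ≠ e) : 0 ≤ α e e j (0, 0, 0) := by
  obtain ⟨_, _, h3⟩ := (orthant_iff_coefficients α).1 hO
  have h := h3 j (Pi.single e 1) (fun i => by by_cases hi : i = e <;> simp [hi])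
    (by simp [hje])
  rw [Finset.sum_eq_single e, Finset.sum_eq_single e] at h
  · simpa using h
  · intro b _ hb; simp [hb]
  · intro h'; exact absurd (Finset.mem_univ e) h'
  · intro b _ hb
    exact Finset.sum_eq_zero fun i _ => by simp [Pi.single_apply, hb]
  · intro h'; exact absurd (Finset.mem_univ e) h'

/-- **Splitting a shell form at one coordinate** (algebra on `Fin 4`): with `ŷ = y` off `e` and `ŷ_e = 0`,
`Σ M_{i₁i₂} y_{i₁}y_{i₂} = Σ M_{i₁i₂} ŷ_{i₁}ŷ_{i₂} + y_e·Σ_j (M_{ej} + M_{je}) ŷ_j + M_{ee} y_e²`.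
[folklore bilinear algebra; this file] -/
theorem inShell_form_split (M : Fin 4 → Fin 4 → ℝ) (y : Fin 4 → ℝ) (e : Fin 4) :
    ∑ i₁, ∑ i₂, M i₁ i₂ * (y i₁ * y i₂) =
      ∑ i₁, ∑ i₂, M i₁ i₂ * (Function.update y e 0 i₁ * Function.update y e 0 i₂) +
        y e * ∑ j, (M e j + M j e) * Function.update y e 0 j + M e e * y e ^ 2 := by
  fin_cases e <;> simp [Fin.sum_univ_four, Function.update] <;> ring

/-! ## §2 The source side -/

/-- **SOURCE SIDE OF THE PAIR.**  For a KP network proper and a family `X` that is non-negative on the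
shells `n` and `n + 1`, the nonlinearity driving a source `X_{a,n}` is at most its inputs — the feeds
from the shell below plus the in-shell form evaluated on the face `{X_a = 0}` — minus the drain through
ANY ONE of its targets `e`: `quadTerm_a(n) ≤ IN_a(n) − w_{ae}(1+ε₀)^{5n/2} X_{a,n} X_{e,n+1}`.
MODEL lattice inequality. [this file] -/
theorem kpProper_quadTerm_source_le (hs : IsSymmetricCoeff α) (hc : IsCancellingCoeff α)
    (hO : ∀ (Y : Fin 4 → ℤ → ℝ → ℝ) (τ : ℝ), (∀ (j : Fin 4) (k : ℤ), 1 ≤ k → 0 ≤ Y j k τ) →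
      ∀ δ : ℝ, 0 < δ → ∀ (i : Fin 4) (n : ℤ), 1 ≤ n → Y i n τ = 0 → 0 ≤ quadTerm δ α Y i n τ)
    (hD : ∀ a b i : Fin 4, a ≠ b → α a b i (0, 0, 1) = 0)
    {ε₀ : ℝ} (hε : 0 < 1 + ε₀) (X : Fin 4 → ℤ → ℝ → ℝ) (a e : Fin 4) (n : ℤ) (t : ℝ)
    (hn : ∀ j, 0 ≤ X j n t) (hn1 : ∀ j, 0 ≤ X j (n + 1) t) :
    quadTerm ε₀ α X a n t ≤
      (1 + ε₀) ^ ((5 : ℝ) * ((n : ℝ) - 1) / 2) * ∑ a', α a' a' a (0, 0, 1) * X a' (n - 1) t ^ 2 +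
        (1 + ε₀) ^ ((5 : ℝ) * n / 2) * ∑ i₁, ∑ i₂, α i₁ i₂ a (0, 0, 0) *
          (Function.update (fun j => X j n t) a 0 i₁ * Function.update (fun j => X j n t) a 0 i₂) -
        α a a e (0, 0, 1) * (1 + ε₀) ^ ((5 : ℝ) * n / 2) * X a n t * X e (n + 1) t := by
  rw [kpProper_quadTerm hs hc hO hD]
  set L0 : ℝ := (1 + ε₀) ^ ((5 : ℝ) * n / 2) with hL0
  have hL0pos : 0 < L0 := Real.rpow_pos_of_pos hε _
  -- the feed drains: keep only the target `e`
  have hdrain : α a a e (0, 0, 1) * X e (n + 1) t ≤ ∑ j, α a a j (0, 0, 1) * X j (n + 1) t := by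
    rw [← Finset.sum_erase_add _ _ (Finset.mem_univ e)]
    have : 0 ≤ ∑ j ∈ Finset.univ.erase e, α a a j (0, 0, 1) * X j (n + 1) t :=
      Finset.sum_nonneg fun j _ => mul_nonneg (kpProper_feed_nonneg hO a j) (hn1 j)
    linarith
  -- the in-shell part: split at the coordinate `a`
  have hsplit := inShell_form_split (fun i₁ i₂ => α i₁ i₂ a (0, 0, 0)) (fun j => X j n t) a
  have hlin : ∑ j, (α a j a (0, 0, 0) + α j a a (0, 0, 0)) * Function.update (fun j => X j n t) a 0 j ≤ 0 := by
    refine Finset.sum_nonpos fun j _ => ?_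
    rw [kpProper_inShell_back hc a j]
    by_cases hja : j = a
    · simp [hja]
    · have h1 : 0 ≤ α a a j (0, 0, 0) := kpProper_pump_nonneg hO hja
      have h2 : Function.update (fun j => X j n t) a 0 j = X j n t := by simp [Function.update, hja]
      rw [h2]
      nlinarith [hn j]
  have hdiag : α a a a (0, 0, 0) = 0 := kpProper_inShell_diag_zero hc a
  rw [hsplit, hdiag]
  have hXa : 0 ≤ X a n t := hn a
  have h1 : L0 * (X a n t * ∑ j, α a a j (0, 0, 1) * X j (n + 1) t) ≥
      L0 * (X a n t * (α a a e (0, 0, 1) * X e (n + 1) t)) :=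
    mul_le_mul_of_nonneg_left (mul_le_mul_of_nonneg_left hdrain hXa) hL0pos.le
  have h2 : L0 * (X a n t * ∑ j, (α a j a (0, 0, 0) + α j a a (0, 0, 0)) *
      Function.update (fun j => X j n t) a 0 j) ≤ 0 := by
    have := mul_nonpos_of_nonneg_of_nonpos hXa hlin
    nlinarith
  nlinarith

/-! ## §3 The target side -/

/-- **TARGET SIDE OF THE PAIR.**  For a KP network proper and a family `X` that is non-negative on the
shell `n + 1`, the nonlinearity driving the target `X_{e,n+1}` is at least the feed from
the source `a` minus the target's own drains, whose RATE is linear in the amplitudes of its partners: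
`quadTerm_e(n+1) ≥ w_{ae}(1+ε₀)^{5n/2} X_{a,n}² − X_{e,n+1}·(1+ε₀)^{5(n+1)/2}(Σ_j w_{ej}X_{j,n+2} + Σ_j P_{e→j}X_{j,n+1})`.
MODEL lattice inequality. [this file] -/
theorem kpProper_quadTerm_target_ge (hs : IsSymmetricCoeff α) (hc : IsCancellingCoeff α)
    (hO : ∀ (Y : Fin 4 → ℤ → ℝ → ℝ) (τ : ℝ), (∀ (j : Fin 4) (k : ℤ), 1 ≤ k → 0 ≤ Y j k τ) →
      ∀ δ : ℝ, 0 < δ → ∀ (i : Fin 4) (n : ℤ), 1 ≤ n → Y i n τ = 0 → 0 ≤ quadTerm δ α Y i n τ)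
    (hD : ∀ a b i : Fin 4, a ≠ b → α a b i (0, 0, 1) = 0)
    {ε₀ : ℝ} (hε : 0 < 1 + ε₀) (X : Fin 4 → ℤ → ℝ → ℝ) (a e : Fin 4) (n : ℤ) (t : ℝ)
    (hn1 : ∀ j, 0 ≤ X j (n + 1) t) :
    α a a e (0, 0, 1) * (1 + ε₀) ^ ((5 : ℝ) * n / 2) * X a n t ^ 2 -
        X e (n + 1) t * ((1 + ε₀) ^ ((5 : ℝ) * (((n + 1 : ℤ) : ℝ)) / 2) *
          (∑ j, α e e j (0, 0, 1) * X j (n + 2) t + ∑ j, α e e j (0, 0, 0) * X j (n + 1) t)) ≤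
      quadTerm ε₀ α X e (n + 1) t := by
  rw [kpProper_quadTerm hs hc hO hD]
  have e1 : (n + 1 : ℤ) - 1 = n := by ring
  have e2 : (n + 1 : ℤ) + 1 = n + 2 := by ring
  have e3 : ((5 : ℝ) * ((((n + 1 : ℤ)) : ℝ) - 1) / 2) = (5 : ℝ) * n / 2 := by push_cast; ring
  rw [e1, e2, e3]
  set L0 : ℝ := (1 + ε₀) ^ ((5 : ℝ) * n / 2) with hL0
  set L1 : ℝ := (1 + ε₀) ^ ((5 : ℝ) * (((n + 1 : ℤ) : ℝ)) / 2) with hL1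
  have hL0pos : 0 < L0 := Real.rpow_pos_of_pos hε _
  have hL1pos : 0 < L1 := Real.rpow_pos_of_pos hε _
  -- the feeds into `e`: keep only the source `a`
  have hfeed : α a a e (0, 0, 1) * X a n t ^ 2 ≤ ∑ a', α a' a' e (0, 0, 1) * X a' n t ^ 2 := by
    rw [← Finset.sum_erase_add _ _ (Finset.mem_univ a)]
    have : 0 ≤ ∑ a' ∈ Finset.univ.erase a, α a' a' e (0, 0, 1) * X a' n t ^ 2 :=
      Finset.sum_nonneg fun a' _ => mul_nonneg (kpProper_feed_nonneg hO a' e) (sq_nonneg _)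
    linarith
  -- the in-shell part at shell `n+1`: split at the coordinate `e`
  have hsplit := inShell_form_split (fun i₁ i₂ => α i₁ i₂ e (0, 0, 0)) (fun j => X j (n + 1) t) e
  obtain ⟨_, _, h3⟩ := (orthant_iff_coefficients α).1 hO
  have hface : 0 ≤ ∑ i₁, ∑ i₂, α i₁ i₂ e (0, 0, 0) *
      (Function.update (fun j => X j (n + 1) t) e 0 i₁ * Function.update (fun j => X j (n + 1) t) e 0 i₂) :=
    h3 e _ (fun i => by by_cases hi : i = e <;> simp [Function.update, hi, hn1 i]) (by simp)
  have hlin : ∑ j, (α e j e (0, 0, 0) + α j e e (0, 0, 0)) * Function.update (fun j => X j (n + 1) t) e 0 j =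
      -∑ j, α e e j (0, 0, 0) * X j (n + 1) t := by
    rw [← Finset.sum_neg_distrib]
    refine Finset.sum_congr rfl fun j _ => ?_
    rw [kpProper_inShell_back hc e j]
    by_cases hje : j = e
    · rw [hje, kpProper_inShell_diag_zero hc e]; simp
    · simp [Function.update, hje]
  have hdiag : α e e e (0, 0, 0) = 0 := kpProper_inShell_diag_zero hc e
  rw [hsplit, hlin, hdiag]
  have hXe : 0 ≤ X e (n + 1) t := hn1 e
  have h1 : L0 * (α a a e (0, 0, 1) * X a n t ^ 2) ≤ L0 * ∑ a', α a' a' e (0, 0, 1) * X a' n t ^ 2 :=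
    mul_le_mul_of_nonneg_left hfeed hL0pos.le
  have h2 : 0 ≤ L1 * ∑ i₁, ∑ i₂, α i₁ i₂ e (0, 0, 0) *
      (Function.update (fun j => X j (n + 1) t) e 0 i₁ * Function.update (fun j => X j (n + 1) t) e 0 i₂) :=
    mul_nonneg hL1pos.le hface
  nlinarith

end Summit.NavierStokesRegularity.NavierStokesRegularity.Theorems

end
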